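import Summits.Ventures.PackingBounds.Configurations.CL18Count

/-!
# Cohn–Li in dimension `18`, IV: pairwise inner products `≤ 144`

Framing: lottery ticket; floor = certified bounds/negative ranges. Venture `PackingBounds` (cell
`pub-packcert`, seat `pub-packcert-energy`).

The "straightforward computation" of Cohn–Li (arXiv:2411.04916, §4) for the `7654` integer vectors `cl18Int`
(`CL18Count.lean`, norm `288`): distinct vectors have integer inner product `≤ 144`. Four classes: `A`
(`(±12) e_k + (±12) e_l`, against anything by the size of the entries), `O` (odd `±6` patterns on the `78` supports
`wd` with axis values `(eT, gT)`: two distinct supports by the kernel pair table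
`36 |S ∩ S'| + |2 e e' + 6 g g'| ≤ 144`, a common support by the two odd patterns differing twice or the axis signs
being opposite), `W` (the six axis vectors), `D` (the `256` twisted deep holes: against `O` by Cohn–Li's parity
argument `C₈ ⊥ wd`, among themselves by `wt ≥ 6`, or `wt = 4` with opposite twist). Result: `ip_le_of_mem18`.

## References
* H. Cohn, A. Li, *Improved kissing numbers in seventeen through twenty-one dimensions*, arXiv:2411.04916 (2024), §4. [`CohnLi2024`]
-/

namespace Summit.Ventures.PackingBounds.Config.CL17

open Finset Leech Golay

/-! ### Small facts about signs -/

/-- A product of two signs is `±1`. -/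
theorem sgn_mul_sgn_cases (u v : Bool) : sgn u * sgn v = 1 ∨ sgn u * sgn v = -1 := by
  rcases sgn_cases u with h | h <;> rcases sgn_cases v with h' | h' <;> simp [h, h']

/-- `s t ≤ |t|` for a sign `s = ±1`. -/
theorem sgn_mul_sgn_mul_le_abs (u v : Bool) (t : ℤ) : sgn u * sgn v * t ≤ |t| := by
  rcases sgn_mul_sgn_cases u v with h | h <;> rw [h] <;> simp [le_abs_self, neg_le_abs]

/-- The axis term of two odd-pattern vectors is a sign times the tabulated one. -/
theorem axis_term (i i' : ℕ) (u v : Bool) :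
    2 * (eT i * sgn u) * (eT i' * sgn v) + 6 * (gT i * sgn u) * (gT i' * sgn v) =
      sgn u * sgn v * (2 * eT i * eT i' + 6 * gT i * gT i') := by
  ring

/-! ### Entries on the cells -/

/-- Entries on the cells are bounded: `6` for `O`, `0` for `W`, `4` for `D`. -/
theorem abs_apply_le_of_mem18 {x : Fin 24 → ℤ} :
    (x ∈ setO → ∀ j : Fin 24, j.val < 16 → |x j| ≤ 6) ∧ (x ∈ setW → ∀ j : Fin 24, j.val < 16 → |x j| ≤ 0) ∧
    (x ∈ setD18 → ∀ j : Fin 24, j.val < 16 → |x j| ≤ 4) := by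
  refine ⟨fun hx j hj => ?_, fun hx j hj => ?_, fun hx j hj => ?_⟩
  · obtain ⟨i, _, f, c, -, rfl⟩ := exists_of_mem_setO hx
    exact (abs_qvec_apply_le _ _ _ _ hj).trans (by norm_num)
  · rw [setW, mem_union] at hx
    rcases hx with hx | hx
    · obtain ⟨c, rfl⟩ := mem_setT18.mp hx
      exact (abs_qvec_apply_le _ _ _ _ hj).trans (by norm_num)
    · obtain ⟨c, c', rfl⟩ := mem_setU.mp hx
      exact (abs_qvec_apply_le _ _ _ _ hj).trans (by norm_num)
  · obtain ⟨m, _, rfl⟩ := mem_setD18.mp hx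
    exact (abs_qvec_apply_le _ _ _ _ hj).trans (by norm_num)

/-! ### Shape `A` -/

/-- Shape `A` at scale `6` is twice shape `A` at scale `3`. -/
theorem aV18_eq_two_smul (k l : Fin 24) (a b : Bool) : aV18 k l a b = (2 : ℤ) • aV k l a b := by
  funext j
  simp only [aV18, aV, pvec, Pi.smul_apply, smul_eq_mul]
  split_ifs <;> ring

/-- `ip (2x) (2y) = 4 ip x y`. -/
theorem ip_two_smul (x y : Fin 24 → ℤ) : ip ((2 : ℤ) • x) ((2 : ℤ) • y) = 4 * ip x y := by
  simp only [ip, Pi.smul_apply, smul_eq_mul, Finset.mul_sum]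
  exact Finset.sum_congr rfl fun j _ => by ring

/-- Shape `A` against a vector with cell entries of absolute value `≤ b`: `ip ≤ 24 b`. -/
theorem ip_setA18_le {x y : Fin 24 → ℤ} (hx : x ∈ setA18) {b : ℤ} (hy : ∀ j : Fin 24, j.val < 16 → |y j| ≤ b) :
    ip x y ≤ 24 * b := by
  obtain ⟨k, l, a, c, ⟨hkl, hl⟩, rfl⟩ := mem_setA18.mp hx
  have hk : k.val < 16 := lt_trans hkl hl
  rw [ip_comm, aV18]
  have h := ip_pvec_pair_le hk hl (ne_of_lt hkl) (fun j => if j = k then a else c) 12 (hy k hk) (hy l hl)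
  have h12 : (2 : ℤ) * |12| * b = 24 * b := by norm_num
  linarith

/-- `A · A ≤ 144` for distinct vectors (four times the scale-`3` bound). -/
theorem ip_AA18 {x y : Fin 24 → ℤ} (hx : x ∈ setA18) (hy : y ∈ setA18) (hne : x ≠ y) : ip x y ≤ 144 := by
  obtain ⟨k, l, a, b, hkl, rfl⟩ := mem_setA18.mp hx
  obtain ⟨k', l', a', b', hkl', rfl⟩ := mem_setA18.mp hy
  rw [aV18_eq_two_smul, aV18_eq_two_smul] at hne ⊢
  rw [ip_two_smul]
  have hne' : aV k l a b ≠ aV k' l' a' b' := fun h => hne (by rw [h])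
  have h := ip_AA (mem_setA.mpr ⟨k, l, a, b, hkl, rfl⟩) (mem_setA.mpr ⟨k', l', a', b', hkl', rfl⟩) hne'
  linarith

/-! ### Odd patterns -/

/-- The support size as the kernel's bit count. -/
theorem card_supp_eq_popK (m : ℕ) : ((supp m).card : ℤ) = (popK 24 24 m : ℤ) := by
  rw [← wt_eq_popK]; rfl

/-- **`O · O ≤ 144`** for distinct odd-pattern vectors. -/
theorem ip_OO {x y : Fin 24 → ℤ} (hx : x ∈ setO) (hy : y ∈ setO) (hne : x ≠ y) : ip x y ≤ 144 := by
  obtain ⟨i, hi, f, c, hf, rfl⟩ := exists_of_mem_setO hx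
  obtain ⟨i', hi', f', c', hf', rfl⟩ := exists_of_mem_setO hy
  by_cases hii : i = i'
  · subst hii
    obtain ⟨-, -, h5a, h5b, -, -, -, -, -, hk0⟩ := wd_facts i hi
    rw [← card_supp_eq_popK] at h5a h5b
    by_cases hf2 : ∃ j ∈ supp (wd i), f j ≠ f' j
    · have h := ip_qvec_qvec_le_of_odd_odd (supp_wd_sub hi) hf hf' hf2 (by norm_num : (0 : ℤ) ≤ 6 * 6)
        (eT i * sgn c) (gT i * sgn c) (eT i * sgn c') (gT i * sgn c')
      have hax := sgn_mul_sgn_mul_le_abs c c' (2 * eT i * eT i + 6 * gT i * gT i)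
      have hk : |2 * eT i * eT i + 6 * gT i * gT i| = kO i := by rw [kO] at hk0 ⊢; exact abs_of_nonneg hk0
      have hat := axis_term i i c c'
      linarith
    · push Not at hf2
      have hcc : sgn c * sgn c' = -1 := by
        rcases sgn_mul_sgn_cases c c' with hs | hs
        · exfalso; apply hne
          have hc : c = c' := by revert hs; cases c <;> cases c' <;> simp
          subst hc; exact qvec_congr hf2 _ _ _
        · exact hs
      have h30 : 30 ≤ i := by
        by_contra hlt
        push Not at hlt
        apply hne
        have he : eT i = 0 := by simp [eT, hlt]
        have hg : gT i = 0 := by simp [gT, show i < 46 by omega]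
        rw [he, hg]; simp only [zero_mul]; exact qvec_congr hf2 _ _ _
      have h := ip_qvec_qvec_le_inter (supp_wd_sub hi) (supp_wd_sub hi) f f' (by norm_num : (0 : ℤ) ≤ 6 * 6)
        (eT i * sgn c) (gT i * sgn c) (eT i * sgn c') (gT i * sgn c')
      rw [Finset.inter_self] at h
      have hk : 2 * (eT i * sgn c) * (eT i * sgn c') + 6 * (gT i * sgn c) * (gT i * sgn c') = - kO i := by
        rw [axis_term, hcc, kO]; ring
      linarith [h5b h30]
  · have hII := wd_inter_le hi hi' hii
    have h := ip_qvec_qvec_le_inter (supp_wd_sub hi) (supp_wd_sub hi') f f' (by norm_num : (0 : ℤ) ≤ 6 * 6)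
      (eT i * sgn c) (gT i * sgn c) (eT i' * sgn c') (gT i' * sgn c')
    have hax := sgn_mul_sgn_mul_le_abs c c' (2 * eT i * eT i' + 6 * gT i * gT i')
    rw [← axis_term] at hax
    linarith

/-- `O · W ≤ 144` (only the axes contribute). -/
theorem ip_OW {x y : Fin 24 → ℤ} (hx : x ∈ setO) (hy : y ∈ setW) : ip x y ≤ 144 := by
  obtain ⟨i, hi, f, c, -, rfl⟩ := exists_of_mem_setO hx
  obtain ⟨-, -, -, -, -, hT, hU, -, he0, -⟩ := wd_facts i hi
  rw [setW, mem_union] at hy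
  rcases hy with hy | hy
  · obtain ⟨c', rfl⟩ := mem_setT18.mp hy
    have h := ip_qvec_qvec_le_inter (supp_wd_sub hi) (Finset.empty_subset _) f (fun _ => false)
      (by norm_num : (0 : ℤ) ≤ 6 * 0) (eT i * sgn c) (gT i * sgn c) (12 * sgn c') 0
    rw [Finset.inter_empty, Finset.card_empty] at h
    have h1 : 2 * (eT i * sgn c) * (12 * sgn c') ≤ 24 * eT i := by
      rcases sgn_cases c with h1 | h1 <;> rcases sgn_cases c' with h2 | h2 <;> rw [h1, h2] <;> linarith
    have h2 : 6 * (gT i * sgn c) * (0 : ℤ) = 0 := by ring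
    linarith
  · obtain ⟨c', d', rfl⟩ := mem_setU.mp hy
    have h := ip_qvec_qvec_le_inter (supp_wd_sub hi) (Finset.empty_subset _) f (fun _ => false)
      (by norm_num : (0 : ℤ) ≤ 6 * 0) (eT i * sgn c) (gT i * sgn c) (6 * sgn c') (6 * sgn d')
    rw [Finset.inter_empty, Finset.card_empty] at h
    have h1 : 2 * (eT i * sgn c) * (6 * sgn c') ≤ 12 * eT i := by
      rcases sgn_cases c with h1 | h1 <;> rcases sgn_cases c' with h2 | h2 <;> rw [h1, h2] <;> linarith
    have h2 : 6 * (gT i * sgn c) * (6 * sgn d') ≤ 36 * |gT i| := by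
      have := sgn_mul_sgn_mul_le_abs c d' (36 * gT i)
      rw [abs_mul, show |(36 : ℤ)| = 36 by norm_num] at this
      linarith
    linarith

/-- **`O · D ≤ 144`**: `C₈` meets the support evenly, the pattern is odd, so at least one sign disagrees. -/
theorem ip_OD {x y : Fin 24 → ℤ} (hx : x ∈ setO) (hy : y ∈ setD18) : ip x y ≤ 144 := by
  obtain ⟨i, hi, f, c, hf, rfl⟩ := exists_of_mem_setO hx
  obtain ⟨m, _, rfl⟩ := mem_setD18.mp hy
  obtain ⟨-, -, -, -, h5c, -, -, -, he0, -⟩ := wd_facts i hi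
  rw [← card_supp_eq_popK] at h5c
  have hev : Even ((supp (wd i)).filter fun j : Fin 24 => (c8 m).testBit j.val = true).card := by
    rw [card_filter_testBit]; exact even_card_wd_inter_c8 hi m
  have h := ip_qvec_qvec_le_of_odd_even (supp_wd_sub hi) subset_rfl hf hev (by norm_num : (0 : ℤ) ≤ 6 * 4)
    (eT i * sgn c) (gT i * sgn c) (4 * sgn (chi (c8 m))) 0
  have h1 : 2 * (eT i * sgn c) * (4 * sgn (chi (c8 m))) ≤ 8 * eT i := by
    rcases sgn_cases c with h1 | h1 <;> rcases sgn_cases (chi (c8 m)) with h2 | h2 <;> rw [h1, h2] <;> linarith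
  have h2 : 6 * (gT i * sgn c) * (0 : ℤ) = 0 := by ring
  linarith

/-! ### Axis vectors and deep holes -/

/-- Inner products of axis vectors. -/
theorem ip_axisvec (e g e' g' : ℤ) :
    ip (qvec ∅ (fun _ => false) 0 e g) (qvec ∅ (fun _ => false) 0 e' g') = 2 * e * e' + 6 * g * g' := by
  rw [ip_qvec_qvec (Finset.empty_subset _) (Finset.empty_subset _),
    ip_pvec_pvec (Finset.empty_subset _) (Finset.empty_subset _)]
  simp

/-- The numerical cases of two distinct axis vectors. -/
theorem axis_cases :
    (∀ c c' : Bool, c ≠ c' → 2 * (12 * sgn c) * (12 * sgn c') + 6 * 0 * 0 ≤ (144 : ℤ)) ∧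
    (∀ c c' d' : Bool, 2 * (12 * sgn c) * (6 * sgn c') + 6 * 0 * (6 * sgn d') ≤ (144 : ℤ)) ∧
    (∀ c d c' : Bool, 2 * (6 * sgn c) * (12 * sgn c') + 6 * (6 * sgn d) * 0 ≤ (144 : ℤ)) ∧
    (∀ c d c' d' : Bool, (c, d) ≠ (c', d') →
      2 * (6 * sgn c) * (6 * sgn c') + 6 * (6 * sgn d) * (6 * sgn d') ≤ (144 : ℤ)) := by
  refine ⟨?_, ?_, ?_, ?_⟩ <;> decide

/-- `W · W ≤ 144` for distinct axis vectors. -/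
theorem ip_WW {x y : Fin 24 → ℤ} (hx : x ∈ setW) (hy : y ∈ setW) (hne : x ≠ y) : ip x y ≤ 144 := by
  obtain ⟨hTT, hTU, hUT, hUU⟩ := axis_cases
  rw [setW, mem_union] at hx hy
  rcases hx with hx | hx <;> rcases hy with hy | hy
  · obtain ⟨c, rfl⟩ := mem_setT18.mp hx
    obtain ⟨c', rfl⟩ := mem_setT18.mp hy
    rw [ip_axisvec]; exact hTT c c' (fun h => hne (by rw [h]))
  · obtain ⟨c, rfl⟩ := mem_setT18.mp hx
    obtain ⟨c', d', rfl⟩ := mem_setU.mp hy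
    rw [ip_axisvec]; exact hTU c c' d'
  · obtain ⟨c, d, rfl⟩ := mem_setU.mp hx
    obtain ⟨c', rfl⟩ := mem_setT18.mp hy
    rw [ip_axisvec]; exact hUT c d c'
  · obtain ⟨c, d, rfl⟩ := mem_setU.mp hx
    obtain ⟨c', d', rfl⟩ := mem_setU.mp hy
    rw [ip_axisvec]; exact hUU c d c' d' (fun h => hne (by rw [Prod.mk.injEq] at h; rw [h.1, h.2]))

/-- `W · D ≤ 144` (only the `√2`-axis contributes: `≤ 96`). -/
theorem ip_WD {x y : Fin 24 → ℤ} (hx : x ∈ setW) (hy : y ∈ setD18) : ip x y ≤ 144 := by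
  obtain ⟨m, _, rfl⟩ := mem_setD18.mp hy
  have key : ∀ e g : ℤ, |e| ≤ 12 →
      ip (qvec ∅ (fun _ => false) 0 e g) (qvec cells (fun j => (c8 m).testBit j.val) 4 (4 * sgn (chi (c8 m))) 0)
        ≤ 144 := by
    intro e g he
    have h := ip_qvec_qvec_le_inter (Finset.empty_subset cells) subset_rfl (fun _ => false)
      (fun j => (c8 m).testBit j.val) (by norm_num : (0 : ℤ) ≤ 0 * 4) e g (4 * sgn (chi (c8 m))) 0
    rw [Finset.empty_inter, Finset.card_empty] at h
    rw [abs_le] at he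
    rcases sgn_cases (chi (c8 m)) with h1 | h1 <;> rw [h1] at h ⊢ <;> linarith
  rw [setW, mem_union] at hx
  rcases hx with hx | hx
  · obtain ⟨c, rfl⟩ := mem_setT18.mp hx
    exact key _ _ (by rcases sgn_cases c with h | h <;> rw [h] <;> norm_num)
  · obtain ⟨c, d, rfl⟩ := mem_setU.mp hx
    exact key _ _ (by rcases sgn_cases c with h | h <;> rw [h] <;> norm_num)

/-- **`D · D ≤ 144`** (in fact `≤ 96`): weight `≥ 6`, or weight `≥ 4` with opposite twists. -/
theorem ip_DD18 {x y : Fin 24 → ℤ} (hx : x ∈ setD18) (hy : y ∈ setD18) (hne : x ≠ y) : ip x y ≤ 144 := by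
  obtain ⟨m, hm, rfl⟩ := mem_setD18.mp hx
  obtain ⟨m', hm', rfl⟩ := mem_setD18.mp hy
  have hmm : m ≠ m' := fun h => hne (by rw [h])
  rw [ip_qvec_cells]
  have e : 2 * (4 * sgn (chi (c8 m))) * (4 * sgn (chi (c8 m'))) = 32 * (sgn (chi (c8 m)) * sgn (chi (c8 m'))) := by
    ring
  rw [e]
  rcases wtK_c8_xor hm hm' hmm with h6 | ⟨h4, hx⟩
  · rcases sgn_mul_sgn_cases (chi (c8 m)) (chi (c8 m')) with hs | hs <;> rw [hs] <;> push_cast <;> omega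
  · have hs : sgn (chi (c8 m)) * sgn (chi (c8 m')) = -1 := by
      revert hx; cases chi (c8 m) <;> cases chi (c8 m') <;> simp
    rw [hs]; push_cast; omega

/-! ### All pairs -/

/-- **All pairwise inner products of distinct vectors are `≤ 144`** (half the norm `288`). -/
theorem ip_le_of_mem18 {x y : Fin 24 → ℤ} (hx : x ∈ cl18Int) (hy : y ∈ cl18Int) (hne : x ≠ y) : ip x y ≤ 144 := by
  obtain ⟨hO, hW, hD⟩ := abs_apply_le_of_mem18 (x := y)
  obtain ⟨hO', hW', hD'⟩ := abs_apply_le_of_mem18 (x := x)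
  rcases mem_cl18Int hx with hx | hx | hx | hx <;> rcases mem_cl18Int hy with hy | hy | hy | hy
  · exact ip_AA18 hx hy hne
  · exact (ip_setA18_le hx (hO hy)).trans (by norm_num)
  · exact (ip_setA18_le hx (hW hy)).trans (by norm_num)
  · exact (ip_setA18_le hx (hD hy)).trans (by norm_num)
  · rw [ip_comm]; exact (ip_setA18_le hy (hO' hx)).trans (by norm_num)
  · exact ip_OO hx hy hne
  · exact ip_OW hx hy
  · exact ip_OD hx hy
  · rw [ip_comm]; exact (ip_setA18_le hy (hW' hx)).trans (by norm_num)
  · rw [ip_comm]; exact ip_OW hy hx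
  · exact ip_WW hx hy hne
  · exact ip_WD hx hy
  · rw [ip_comm]; exact (ip_setA18_le hy (hD' hx)).trans (by norm_num)
  · rw [ip_comm]; exact ip_OD hy hx
  · rw [ip_comm]; exact ip_WD hy hx
  · exact ip_DD18 hx hy hne

end Summit.Ventures.PackingBounds.Config.CL17
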